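import Literature.MathematicalPhysics.QuantumFieldTheory.Balaban1983to89.B12Eq46Frechet
import Mathlib.Topology.Algebra.Module.ContinuousLinearMap.PiProd
import Mathlib.Analysis.Normed.Module.Multilinear.Basic

/-!
# Bałaban, *Renormalization group approach to lattice gauge field theories. I* (CMP 109, 1987) [Balaban1987RG1], (4.19)–(4.21)
# p. 285: the Fréchet derivatives `δⁿ𝐄/δBⁿ` AS KERNELS `𝐄⁽ⁿ⁾_{μ₁…μ_n}(x₁,…,x_n)` on the finite bond lattice — definition
# (4.19) with body, the kernel expansion (first line of (4.21)), (4.20) in kernel form, Schwarz symmetry and sup bounds of the kernel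

HONEST FRAMING (cell `lit-balaban`, verbatim): statement-level skeleton of published theorems with citation tags; proofs where landed;
nothing here is a claim about the Yang–Mills mass gap.

PDF held: `paper:balaban1987-cmp109-rg-i-small-field` (journal page = PDF page + 248); p. 285 [PDF 37] and p. 286 [38] re-read by this
seat in the held text layer (`lit read … --pages 37-38`, 2026-08-21).  THE PRINT, p. 285: *«We begin the analysis of (4.6) introducing
simpler notations. We drop the superscript (j) in (4.6), and denote  δⁿ𝐄^{(j)}(X, U_j(□₀,1))/δBⁿ = 𝐄⁽ⁿ⁾(X), or simply 𝐄⁽ⁿ⁾, (4.19)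
hence 𝐄⁽ⁿ⁾ is a (⊗ⁿ𝔤)-valued function 𝐄⁽ⁿ⁾_{μ₁,…,μ_n}(x₁,…,x_n) defined on a neighborhood of □̃⁴ in the unit lattice T₁^{(j)}, and
(4.6) = Σ_{n=2}^{4} (1/(n−1)!) ⟨𝐄⁽ⁿ⁾, δB, ⊗^{n−1}B⟩. (4.20)  Let us consider the third term in the above sum. … We write
⟨𝐄⁽⁴⁾, δB, ⊗³B⟩ = Σ_{(μ,x),…,(μ₃,x₃)} ⟨𝐄⁽⁴⁾_{μ,μ₁,μ₂,μ₃}(x,x₁,x₂,x₃), δB_μ(x), B_{μ₁}(x₁), B_{μ₂}(x₂), B_{μ₃}(x₃)⟩ (4.21, first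
line)»*; p. 286: *«we apply the identities (4.3) with localizations at the points x, x₃ fixed, i.e. with the summations over x, x₃ left
undone … by a similar argument we can bound the derivative 𝐄⁽ⁿ⁾(X, x₁,…,x_n) by a constant times the exponential …»*.

WHAT IS REPRODUCED (SKELETON rows **B12.Eq4.19-4.20** (display owner r09, fold owner r20; head `typed-existing`, decls of record
`B12Marginal444.sum420/pairE` = the SCHEMATIC scalar kernels after the Schur step (4.33)), the kernel-expansion line of **B12.Eq4.21-4.22**
(r20 `B12Sect4Statements`, pub-balaban `B12WTReduction429.eq421` = the SPLIT; the expansion into point kernels itself is in no module), and the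
reading «localizations at the points fixed» of **B12.Txt@286b**).  The configurations `B` of (4.6)/(4.20) are functions on a FINITE index set
`ι` (print: pairs `(x, μ)`, `x` a point of the unit lattice `T₁^{(j)}` near □̃⁴, `μ = 1,…,d`) with values in a normed space `𝔸` (print: `𝔤`,
resp. `𝔤ᶜ`); the configuration space is `ι → 𝔸` with the sup norm; `𝐄` is a map `(ι → 𝔸) → F`.  For such a space an `n`-linear map —
in particular `Dⁿ𝐄(b₀) = iteratedFDeriv 𝕜 n 𝐄 b₀`, `b₀ = U_j(□₀,1)` i.e. `B = 0` — IS a kernel: a function of `n` indices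
`(x₁,μ₁),…,(x_n,μ_n)` with values in `n`-linear maps `𝔸 × ⋯ × 𝔸 → F` (print's «(⊗ⁿ𝔤)-valued», i.e. valued in the dual of `⊗ⁿ𝔤` when
`F = ℂ`), obtained by inserting the point-localized fields `δ_{(x_k,μ_k)} b_k` (`Pi.single`); and the pairing with fields is the finite sum over
all index tuples — the first line of (4.21).  Nothing of this dictionary was in the tree (the B12 §4 modules work either with abstract
«towers» `E →L E →L … →L F` on `Λ → T → V`, or with schematic scalar kernels).

WHAT IS CERTIFIED (kernel, sorry-free; axioms standard; two `def`s with bodies + theorems; no new named fact):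
* §1 `kernelOf M xs` — the kernel of an arbitrary continuous `n`-linear map `M` on `ι → 𝔸` at the index tuple `xs : Fin n → ι`
  (`= M.compContinuousLinearMap (single ∘ xs)`), `kernelOf_apply`; **`apply_eq_sum_kernelOf`** — THE KERNEL EXPANSION
  `M[v₁,…,v_n] = Σ_{xs : Fin n → ι} kernelOf M xs [v₁(xs₁),…,v_n(xs_n)]` (multilinearity, `ContinuousMultilinearMap.map_sum` after
  `v_k = Σ_i δ_i v_k(i)`); **`apply_eq_sum_kernelOf_of_support`** — «defined on a neighborhood of □̃⁴»: if each `v_k` is supported in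
  `S_k` the sum runs over `xs ∈ Π_k S_k` only (`Fintype.piFinset`); `apply_eq_sum_kernelOf_first` — «with the summation over x left
  undone»: expanding the first argument only, `M[v₁,…] = Σ_x M[δ_x v₁(x), v₂, …]`.
* §2 **`kernelE n f b₀ := kernelOf (iteratedFDeriv 𝕜 n f b₀)`** = (4.19) WITH BODY; `kernelE_apply`; **`iteratedFDeriv_apply_eq_sum_kernelE`**
  = the first line of (4.21) for every `n` (`⟨Dⁿ𝐄(b₀), v₁ ⊗ ⋯ ⊗ v_n⟩ = Σ_{(x,μ)…} 𝐄⁽ⁿ⁾_{μ…}(x…)[v₁(x₁,μ₁),…]`), `…_of_support`,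
  `iteratedFDeriv_four_eq_sum_kernelE` (the printed instance `n = 4`, arguments `δB, B, B, B`).
* §3 **`kernelE_perm`** — the kernel is SYMMETRIC under simultaneous permutation of indices and arguments,
  `𝐄⁽ⁿ⁾(xs ∘ σ)[b ∘ σ] = 𝐄⁽ⁿ⁾(xs)[b]`, for `𝐄` of class `C^N`, `n ≤ N` (Schwarz: tree `Literature.Analysis.Calculus.iteratedFDeriv_comp_perm_of_le`);
  `kernelE_two_swap` (`𝐄⁽²⁾_{μν}(x,y)[a,b] = 𝐄⁽²⁾_{νμ}(y,x)[b,a]`, the symmetry used at (4.32)–(4.35)).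
* §4 bounds: `norm_single_le`, **`norm_kernelOf_le`** (`‖kernelOf M xs‖ ≤ ‖M‖`), **`norm_kernelOf_apply_le_of_localized`** — a bound for `M`
  on arguments LOCALIZED at the points `xs` («localizations at the points x, x₃ fixed», p. 286) is a bound for the kernel value:
  `(∀ v localized at xs, ‖M v‖ ≤ C(xs) Π‖v_k‖) → ‖kernelOf M xs b‖ ≤ C(xs) Π‖b_k‖`; `norm_kernelE_apply_le` (from a (4.5)-type bound on `Dⁿ𝐄(b₀)`).
* §5 **(4.20) IN KERNEL FORM** over `ℝ` (print's `𝔤`-valued `B`): `eq420_kernel_of_fderiv_eq_zero` — gen 8's `B12Eq46Frechet.eq420_of_fderiv_eq_zero`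
  ((4.14) `fderiv ℝ 𝐄 b₀ = 0` ⇒ the `t_□`-derivative (4.6) equals `Σ_{n=2}^{4} (1/(n−1)!) Dⁿ𝐄(b₀)[δB, ⊗^{n−1}B]`) with every term expanded
  into its kernel: `… = Σ_{n=2}^{4} (1/(n−1)!) Σ_{xs} 𝐄⁽ⁿ⁾(xs)[δB(xs₁), B(xs₂), …, B(xs_n)]`; `hasDerivAt_taylorSum_kernel` (same along any
  curve `B(τ)`, `𝐄 ∈ C⁴`, all five terms).
MODELLING / HONEST SCOPE.  `ι` finite and abstract (print: bonds of the unit lattice near □̃⁴ with a direction index; the torus is finite);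
`𝔸`, `F` abstract normed spaces over `𝕜` (`ℝ` or `ℂ`; §3 needs `IsRCLikeNormedField 𝕜`, §5 is over `ℝ` as `B12Eq46`); «(⊗ⁿ𝔤)-valued» is
read as «`n`-linear on `𝔤ⁿ`» (for `F = 𝕜` and finite-dimensional `𝔤` the two are canonically isomorphic — not needed, not proved); the
tensor-index notation `𝐄_{μ₁…μ_n}(x₁…x_n)` = `kernelE n 𝐄 b₀ (fun k => (x k, μ k))` when `ι = sites × directions` (remark only).  The
Schur reduction `E_{ab} = Eδ_{ab}` (p. 289) that turns these kernels into the scalar kernels of `B12Marginal444` is row B12.Eq4.32-4.33 and is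
NOT touched.  Mega-formalization `lit-balaban`, HOME `run/shared/lean/pub/lit-balaban/`, Phase-2 proof seat p05 gen 9 (unit `lit-balaban-p05`,
free-target protocol G.5-34(d)).  Imports `…B12Eq46Frechet` (p05 gen 8) and Mathlib BY NAME; modifies nothing there.
-/

noncomputable section

open Finset
open scoped BigOperators Nat

namespace Literature.MathematicalPhysics.QuantumFieldTheory.Balaban1983to89.B12Eq419Kernel

open Literature.MathematicalPhysics.QuantumFieldTheory.Balaban1983to89
open Literature.Analysis.Calculus

section Kernel

variable {𝕜 : Type*} [NontriviallyNormedField 𝕜] {ι : Type*} [Fintype ι] [DecidableEq ι]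
  {𝔸 : Type*} [NormedAddCommGroup 𝔸] [NormedSpace 𝕜 𝔸] {F : Type*} [NormedAddCommGroup F] [NormedSpace 𝕜 F]

/-! ## §1. The kernel of an `n`-linear map on the finite configuration space `ι → 𝔸` and the kernel expansion -/

/-- The KERNEL of a continuous `n`-linear map `M` on the configurations `ι → 𝔸` (print: `B = (B_μ(x))_{(x,μ)}`) at the index tuple
`xs = ((x₁,μ₁),…,(x_n,μ_n))`: the `n`-linear map `(b₁,…,b_n) ↦ M[δ_{xs₁}b₁, …, δ_{xs_n}b_n]` on `𝔸ⁿ` obtained by inserting the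
point-localized configurations `δ_{xs_k} b_k = Pi.single (xs k) (b k)` — print's «(⊗ⁿ𝔤)-valued function 𝐄⁽ⁿ⁾_{μ₁,…,μ_n}(x₁,…,x_n)» for
`M = δⁿ𝐄/δBⁿ`. [cite: Balaban1987RG1, (4.19) p.285] -/
def kernelOf {n : ℕ} (M : ContinuousMultilinearMap 𝕜 (fun _ : Fin n => ι → 𝔸) F) (xs : Fin n → ι) :
    ContinuousMultilinearMap 𝕜 (fun _ : Fin n => 𝔸) F :=
  M.compContinuousLinearMap fun k => ContinuousLinearMap.single 𝕜 (fun _ : ι => 𝔸) (xs k)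

omit [Fintype ι] in
/-- The kernel evaluated: `kernelOf M xs b = M[δ_{xs₁}b₁, …, δ_{xs_n}b_n]`. [cite: Balaban1987RG1, (4.19) p.285] -/
@[simp] theorem kernelOf_apply {n : ℕ} (M : ContinuousMultilinearMap 𝕜 (fun _ : Fin n => ι → 𝔸) F) (xs : Fin n → ι)
    (b : Fin n → 𝔸) : kernelOf M xs b = M fun k => Pi.single (xs k) (b k) := by
  simp [kernelOf, ContinuousMultilinearMap.compContinuousLinearMap_apply]

/-- **THE KERNEL EXPANSION** (first line of (4.21), for an arbitrary `n`-linear `M`): *«⟨𝐄⁽⁴⁾, δB, ⊗³B⟩ = Σ_{(μ,x),…,(μ₃,x₃)}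
⟨𝐄⁽⁴⁾_{μ,μ₁,μ₂,μ₃}(x,x₁,x₂,x₃), δB_μ(x), B_{μ₁}(x₁), B_{μ₂}(x₂), B_{μ₃}(x₃)⟩»* — `M[v₁,…,v_n] = Σ_{xs} kernelOf M xs [v₁(xs₁),…,v_n(xs_n)]`,
the sum over ALL index tuples `xs : Fin n → ι` (multilinearity after `v_k = Σ_i δ_i v_k(i)`). [cite: Balaban1987RG1, (4.21) p.285] -/
theorem apply_eq_sum_kernelOf {n : ℕ} (M : ContinuousMultilinearMap 𝕜 (fun _ : Fin n => ι → 𝔸) F) (v : Fin n → ι → 𝔸) :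
    M v = ∑ xs : Fin n → ι, kernelOf M xs fun k => v k (xs k) := by
  have hv : v = fun k => ∑ i : ι, Pi.single i (v k i) := by
    funext k
    exact (Finset.univ_sum_single (v k)).symm
  conv_lhs => rw [hv]
  rw [ContinuousMultilinearMap.map_sum M (fun k i => Pi.single i (v k i))]
  simp only [kernelOf_apply]

/-- *«… defined on a neighborhood of □̃⁴ …»* (p. 285): only the kernel values at index tuples inside the supports of the arguments
enter — if `v_k` vanishes outside `S_k` then `M[v₁,…,v_n] = Σ_{xs ∈ Π_k S_k} kernelOf M xs [v₁(xs₁),…,v_n(xs_n)]`.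
[cite: Balaban1987RG1, (4.19)–(4.21) p.285] -/
theorem apply_eq_sum_kernelOf_of_support {n : ℕ} (M : ContinuousMultilinearMap 𝕜 (fun _ : Fin n => ι → 𝔸) F)
    (v : Fin n → ι → 𝔸) (S : Fin n → Finset ι) (hv : ∀ k i, i ∉ S k → v k i = 0) :
    M v = ∑ xs ∈ Fintype.piFinset S, kernelOf M xs fun k => v k (xs k) := by
  have hv' : v = fun k => ∑ i ∈ S k, Pi.single i (v k i) := by
    funext k
    have hS : ∑ i ∈ S k, Pi.single i (v k i) = ∑ i, Pi.single i (v k i) :=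
      Finset.sum_subset (Finset.subset_univ (S k)) fun i _ hi => by rw [hv k i hi, Pi.single_zero]
    rw [hS, Finset.univ_sum_single]
  conv_lhs => rw [hv']
  rw [ContinuousMultilinearMap.map_sum_finset M (fun k i => Pi.single i (v k i)) S]
  simp only [kernelOf_apply]

/-- *«… with localizations at the points x, x₃ fixed, i.e. with the summations over x, x₃ left undone»* (p. 286) — expanding ONE argument
only: `M[v₁, v₂, …, v_n] = Σ_{x} M[δ_x v₁(x), v₂, …, v_n]` (the first argument localized at `x`, the others untouched).
[cite: Balaban1987RG1, p.286; (4.21) p.285] -/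
theorem apply_eq_sum_update_single {n : ℕ} (M : ContinuousMultilinearMap 𝕜 (fun _ : Fin (n + 1) => ι → 𝔸) F)
    (v : Fin (n + 1) → ι → 𝔸) (k₀ : Fin (n + 1)) :
    M v = ∑ x : ι, M (Function.update v k₀ (Pi.single x (v k₀ x))) := by
  have h : v = Function.update v k₀ (∑ x : ι, Pi.single x (v k₀ x)) := by
    rw [Finset.univ_sum_single (v k₀), Function.update_eq_self]
  conv_lhs => rw [h]
  exact M.toMultilinearMap.map_update_sum Finset.univ k₀ (fun x => Pi.single x (v k₀ x)) v

/-- The same with TWO summations left undone (*«the summations over x, x₃ left undone»*, p. 286): two distinct arguments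
`k₀ ≠ k₁` localized at the points `x`, `x₃`, the others untouched — `M[v] = Σ_x Σ_{x₃} M[v with v_{k₀} ↦ δ_x v_{k₀}(x),
v_{k₁} ↦ δ_{x₃} v_{k₁}(x₃)]`. [cite: Balaban1987RG1, p.286; (4.21) p.285] -/
theorem apply_eq_sum_sum_update_single {n : ℕ} (M : ContinuousMultilinearMap 𝕜 (fun _ : Fin (n + 1) => ι → 𝔸) F)
    (v : Fin (n + 1) → ι → 𝔸) {k₀ k₁ : Fin (n + 1)} (hk : k₀ ≠ k₁) :
    M v = ∑ x : ι, ∑ x₃ : ι,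
      M (Function.update (Function.update v k₀ (Pi.single x (v k₀ x))) k₁ (Pi.single x₃ (v k₁ x₃))) := by
  rw [apply_eq_sum_update_single M v k₀]
  refine Finset.sum_congr rfl fun x _ => ?_
  rw [apply_eq_sum_update_single M _ k₁]
  refine Finset.sum_congr rfl fun x₃ _ => ?_
  rw [Function.update_of_ne hk.symm]

/-- **(4.21) in its printed two-sum form** (p. 285): with the first argument localized at `x` and, for each `x`, the last field split
as `B = c_x + (B − c_x)` (print: `B_{μ₃}(x₃) = B_{μ₃}(x) + (∂B_{μ₃})(Γ_{x,x₃})`, `c_x` = the field frozen at `x`),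
`M[δB, B, B, B] = Σ_x M[δ_x δB(x), B, B, c_x] + Σ_x M[δ_x δB(x), B, B, B − c_x]` — the first and the second sum of (4.21) (the
pointwise-in-`x` identity is pub-balaban's `B12WTReduction429.eq421`). [cite: Balaban1987RG1, (4.21) p.285] -/
theorem eq421_two_sums (M : ContinuousMultilinearMap 𝕜 (fun _ : Fin 4 => ι → 𝔸) F) (δB B : ι → 𝔸) (c : ι → ι → 𝔸) :
    M ![δB, B, B, B] =
      (∑ x : ι, M ![Pi.single x (δB x), B, B, c x]) + ∑ x : ι, M ![Pi.single x (δB x), B, B, B - c x] := by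
  rw [apply_eq_sum_update_single M _ 0, ← Finset.sum_add_distrib]
  refine Finset.sum_congr rfl fun x _ => ?_
  have h0 : Function.update (![δB, B, B, B] : Fin 4 → ι → 𝔸) 0 (Pi.single x ((![δB, B, B, B] : Fin 4 → ι → 𝔸) 0 x))
      = Function.update ![Pi.single x (δB x), B, B, (0 : ι → 𝔸)] 3 (c x + (B - c x)) := by
    funext k
    fin_cases k <;> simp
  have h1 : (![Pi.single x (δB x), B, B, c x] : Fin 4 → ι → 𝔸)
      = Function.update ![Pi.single x (δB x), B, B, (0 : ι → 𝔸)] 3 (c x) := by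
    funext k
    fin_cases k <;> simp
  have h2 : (![Pi.single x (δB x), B, B, B - c x] : Fin 4 → ι → 𝔸)
      = Function.update ![Pi.single x (δB x), B, B, (0 : ι → 𝔸)] 3 (B - c x) := by
    funext k
    fin_cases k <;> simp
  rw [h0, h1, h2, M.map_update_add]

/-! ## §2. (4.19): the kernels `𝐄⁽ⁿ⁾` of the derivatives `δⁿ𝐄/δBⁿ = Dⁿ𝐄(b₀)` -/

/-- **(4.19)** (p. 285, verbatim): *«denote δⁿ𝐄^{(j)}(X, U_j(□₀,1))/δBⁿ = 𝐄⁽ⁿ⁾(X), or simply 𝐄⁽ⁿ⁾, (4.19) hence 𝐄⁽ⁿ⁾ is a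
(⊗ⁿ𝔤)-valued function 𝐄⁽ⁿ⁾_{μ₁,…,μ_n}(x₁,…,x_n)»* — WITH BODY: the kernel of the `n`-th Fréchet derivative of `𝐄 : (ι → 𝔸) → F`
at the base configuration `b₀` (`= U_j(□₀,1)`, i.e. `B = 0`): `𝐄⁽ⁿ⁾(xs)[b₁,…,b_n] = Dⁿ𝐄(b₀)[δ_{xs₁}b₁,…,δ_{xs_n}b_n]`.
[cite: Balaban1987RG1, (4.19) p.285] -/
def kernelE (n : ℕ) (f : (ι → 𝔸) → F) (b₀ : ι → 𝔸) (xs : Fin n → ι) : ContinuousMultilinearMap 𝕜 (fun _ : Fin n => 𝔸) F :=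
  kernelOf (iteratedFDeriv 𝕜 n f b₀) xs

/-- (4.19) evaluated: `𝐄⁽ⁿ⁾(xs)[b] = Dⁿ𝐄(b₀)[δ_{xs₁}b₁, …, δ_{xs_n}b_n]`. [cite: Balaban1987RG1, (4.19) p.285] -/
@[simp] theorem kernelE_apply (n : ℕ) (f : (ι → 𝔸) → F) (b₀ : ι → 𝔸) (xs : Fin n → ι) (b : Fin n → 𝔸) :
    kernelE (𝕜 := 𝕜) n f b₀ xs b = iteratedFDeriv 𝕜 n f b₀ fun k => Pi.single (xs k) (b k) :=
  kernelOf_apply _ xs b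

/-- **First line of (4.21) for every `n`**: `⟨Dⁿ𝐄(b₀), v₁ ⊗ ⋯ ⊗ v_n⟩ = Σ_{(x₁,μ₁),…,(x_n,μ_n)} 𝐄⁽ⁿ⁾_{μ₁…μ_n}(x₁,…,x_n)[v₁(x₁,μ₁),
…, v_n(x_n,μ_n)]`. [cite: Balaban1987RG1, (4.21) p.285; (4.19) p.285] -/
theorem iteratedFDeriv_apply_eq_sum_kernelE (n : ℕ) (f : (ι → 𝔸) → F) (b₀ : ι → 𝔸) (v : Fin n → ι → 𝔸) :
    iteratedFDeriv 𝕜 n f b₀ v = ∑ xs : Fin n → ι, kernelE (𝕜 := 𝕜) n f b₀ xs fun k => v k (xs k) :=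
  apply_eq_sum_kernelOf _ v

/-- The same with the sum restricted to the supports of the arguments (*«defined on a neighborhood of □̃⁴»*: `δB`, `B` of (4.6) are
localized near □, p. 282). [cite: Balaban1987RG1, (4.19)–(4.21) p.285] -/
theorem iteratedFDeriv_apply_eq_sum_kernelE_of_support (n : ℕ) (f : (ι → 𝔸) → F) (b₀ : ι → 𝔸) (v : Fin n → ι → 𝔸)
    (S : Fin n → Finset ι) (hv : ∀ k i, i ∉ S k → v k i = 0) :
    iteratedFDeriv 𝕜 n f b₀ v = ∑ xs ∈ Fintype.piFinset S, kernelE (𝕜 := 𝕜) n f b₀ xs fun k => v k (xs k) :=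
  apply_eq_sum_kernelOf_of_support _ v S hv

/-- **(4.21), first line, as printed** (`n = 4`, arguments `δB, B, B, B`): `⟨𝐄⁽⁴⁾, δB, ⊗³B⟩ = Σ_{xs : Fin 4 → ι} 𝐄⁽⁴⁾(xs)[δB(xs₀),
B(xs₁), B(xs₂), B(xs₃)]`. [cite: Balaban1987RG1, (4.21) p.285] -/
theorem iteratedFDeriv_four_eq_sum_kernelE (f : (ι → 𝔸) → F) (b₀ δB B : ι → 𝔸) :
    iteratedFDeriv 𝕜 4 f b₀ ![δB, B, B, B] =
      ∑ xs : Fin 4 → ι, kernelE (𝕜 := 𝕜) 4 f b₀ xs ![δB (xs 0), B (xs 1), B (xs 2), B (xs 3)] := by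
  rw [iteratedFDeriv_apply_eq_sum_kernelE]
  refine Finset.sum_congr rfl fun xs _ => ?_
  congr 1
  funext k
  fin_cases k <;> rfl

/-! ## §4. Sup bounds of the kernel: a bound for `M` on point-localized arguments is a bound for `kernelOf M` -/

/-- `‖δ_i‖ ≤ 1` for the insertion `𝔸 →L (ι → 𝔸)` (sup norm; in fact an isometry, `Pi.norm_single`). [cite: Balaban1987RG1, (4.19) p.285] -/
theorem norm_single_le (i : ι) : ‖ContinuousLinearMap.single 𝕜 (fun _ : ι => 𝔸) i‖ ≤ 1 := by
  refine ContinuousLinearMap.opNorm_le_bound _ zero_le_one fun a => ?_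
  simp [Pi.norm_single]

/-- `‖kernelOf M xs‖ ≤ ‖M‖` (operator norms): the kernel values are bounded by the norm of the multilinear map.
[cite: Balaban1987RG1, (4.19) p.285; p.286] -/
theorem norm_kernelOf_le {n : ℕ} (M : ContinuousMultilinearMap 𝕜 (fun _ : Fin n => ι → 𝔸) F) (xs : Fin n → ι) :
    ‖kernelOf M xs‖ ≤ ‖M‖ := by
  refine (ContinuousMultilinearMap.norm_compContinuousLinearMap_le _ _).trans ?_
  have h : ∏ k : Fin n, ‖ContinuousLinearMap.single 𝕜 (fun _ : ι => 𝔸) (xs k)‖ ≤ 1 :=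
    Finset.prod_le_one (fun k _ => norm_nonneg _) fun k _ => norm_single_le (xs k)
  calc ‖M‖ * ∏ k : Fin n, ‖ContinuousLinearMap.single 𝕜 (fun _ : ι => 𝔸) (xs k)‖ ≤ ‖M‖ * 1 :=
        mul_le_mul_of_nonneg_left h (norm_nonneg _)
    _ = ‖M‖ := mul_one _

/-- *«we apply the identities (4.3) with localizations at the points x, x₃ fixed»* (p. 286): a bound for `M` on arguments LOCALIZED
at the points `xs` — `v_k` supported at the single index `xs k` — with a constant `C xs` depending on the points (in print: the
(4.5)-type constant times `exp(−δ₀dist(X,x) − δ₀dist(X,x₃))`) is a bound for the kernel value `𝐄⁽ⁿ⁾(xs)`.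
[cite: Balaban1987RG1, p.286; (4.5) p.282] -/
theorem norm_kernelOf_apply_le_of_localized {n : ℕ} (M : ContinuousMultilinearMap 𝕜 (fun _ : Fin n => ι → 𝔸) F)
    (xs : Fin n → ι) {C : ℝ}
    (hM : ∀ v : Fin n → ι → 𝔸, (∀ k i, i ≠ xs k → v k i = 0) → ‖M v‖ ≤ C * ∏ k, ‖v k‖) (b : Fin n → 𝔸) :
    ‖kernelOf M xs b‖ ≤ C * ∏ k, ‖b k‖ := by
  rw [kernelOf_apply]
  have h := hM (fun k => Pi.single (xs k) (b k)) fun k i hi => by simp [hi]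
  simpa [Pi.norm_single] using h

/-- A (4.5)-type bound `‖Dⁿ𝐄(b₀)[v₁,…,v_n]‖ ≤ C Π‖v_k‖` gives `‖𝐄⁽ⁿ⁾(xs)[b]‖ ≤ C Π‖b_k‖` for every index tuple.
[cite: Balaban1987RG1, (4.5) p.282; p.286] -/
theorem norm_kernelE_apply_le (n : ℕ) (f : (ι → 𝔸) → F) (b₀ : ι → 𝔸) {C : ℝ}
    (hC : ∀ v : Fin n → ι → 𝔸, ‖iteratedFDeriv 𝕜 n f b₀ v‖ ≤ C * ∏ k, ‖v k‖) (xs : Fin n → ι) (b : Fin n → 𝔸) :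
    ‖kernelE (𝕜 := 𝕜) n f b₀ xs b‖ ≤ C * ∏ k, ‖b k‖ :=
  norm_kernelOf_apply_le_of_localized _ xs (fun v _ => hC v) b

end Kernel

/-! ## §3. Schwarz symmetry of the kernels -/

section Symmetry

variable {𝕜 : Type*} [NontriviallyNormedField 𝕜] [IsRCLikeNormedField 𝕜] {ι : Type*} [Fintype ι] [DecidableEq ι]
  {𝔸 : Type*} [NormedAddCommGroup 𝔸] [NormedSpace 𝕜 𝔸] {F : Type*} [NormedAddCommGroup F] [NormedSpace 𝕜 F]

/-- **The kernel `𝐄⁽ⁿ⁾` is symmetric** under simultaneous permutation of the indices `(x_k, μ_k)` and of the arguments: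
`𝐄⁽ⁿ⁾(xs ∘ σ)[b ∘ σ] = 𝐄⁽ⁿ⁾(xs)[b]` for `𝐄` of class `C^N` at `b₀`, `n ≤ N` — because `Dⁿ𝐄(b₀)` is a symmetric `n`-linear map
(Schwarz; tree `Literature.Analysis.Calculus.iteratedFDeriv_comp_perm_of_le`).  This is the symmetry print uses silently when it writes
`⟨𝐄⁽ⁿ⁾, δB, ⊗^{n−1}B⟩` without specifying a slot for `δB`, and explicitly at (4.11) («B₁ ↔ B₂»). [cite: Balaban1987RG1, (4.19)–(4.20) p.285; (4.11) p.283] -/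
theorem kernelE_perm {N : WithTop ℕ∞} {f : (ι → 𝔸) → F} {b₀ : ι → 𝔸} (hf : ContDiffAt 𝕜 N f b₀) {n : ℕ}
    (hn : (n : WithTop ℕ∞) ≤ N) (σ : Equiv.Perm (Fin n)) (xs : Fin n → ι) (b : Fin n → 𝔸) :
    kernelE (𝕜 := 𝕜) n f b₀ (xs ∘ σ) (b ∘ σ) = kernelE (𝕜 := 𝕜) n f b₀ xs b := by
  rw [kernelE_apply, kernelE_apply]
  exact iteratedFDeriv_comp_perm_of_le hf hn (fun k => Pi.single (xs k) (b k)) σ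

/-- The case `n = 2`: `𝐄⁽²⁾_{μν}(x,y)[a,b] = 𝐄⁽²⁾_{νμ}(y,x)[b,a]` (the symmetry of the kernel `𝐄⁽²⁾(X,x,y)` of (4.34)–(4.35)).
[cite: Balaban1987RG1, (4.19) p.285; (4.35) p.290] -/
theorem kernelE_two_swap {N : WithTop ℕ∞} {f : (ι → 𝔸) → F} {b₀ : ι → 𝔸} (hf : ContDiffAt 𝕜 N f b₀) (hN : (2 : WithTop ℕ∞) ≤ N)
    (x y : ι) (a b : 𝔸) :
    kernelE (𝕜 := 𝕜) 2 f b₀ ![y, x] ![b, a] = kernelE (𝕜 := 𝕜) 2 f b₀ ![x, y] ![a, b] := by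
  have h := kernelE_perm (𝕜 := 𝕜) hf (n := 2) (by exact_mod_cast hN) (Equiv.swap 0 1) ![x, y] ![a, b]
  have e1 : (![x, y] : Fin 2 → ι) ∘ (Equiv.swap (0 : Fin 2) 1) = ![y, x] := by
    funext k; fin_cases k <;> rfl
  have e2 : (![a, b] : Fin 2 → 𝔸) ∘ (Equiv.swap (0 : Fin 2) 1) = ![b, a] := by
    funext k; fin_cases k <;> rfl
  rw [e1, e2] at h
  exact h

end Symmetry

/-! ## §5. (4.20) in kernel form (over `ℝ`, as `B12Eq46`/`B12Eq46Frechet`) -/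

section Eq420

variable {ι : Type*} [Fintype ι] [DecidableEq ι] {𝔸 : Type*} [NormedAddCommGroup 𝔸] [NormedSpace ℝ 𝔸]
  {F : Type*} [NormedAddCommGroup F] [NormedSpace ℝ F] {EA : Type*} [NormedAddCommGroup EA] [NormedSpace ℝ EA]

/-- The differentiated «sum over n» of p. 282 along any curve `B(τ)` (`B(0) = B₀`, `B′(0) = δB`), `𝐄 ∈ C⁴` at `b₀`, EVERY TERM IN
KERNEL FORM: `(d/dτ)|₀ Σ_{n≤4} (1/n!) Dⁿ𝐄(b₀)[⊗ⁿB(τ)] = Σ_{n=1}^{4} (1/(n−1)!) Σ_{xs} 𝐄⁽ⁿ⁾(xs)[δB(xs₁), B₀(xs₂), …, B₀(xs_n)]`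
(index written `n ↦ n+1`; gen 8's `B12Eq46Frechet.hasDerivAt_taylorSum` + §2). [cite: Balaban1987RG1, (4.6) p.282; (4.19)–(4.20) p.285] -/
theorem hasDerivAt_taylorSum_kernel {f : (ι → 𝔸) → F} {b₀ : ι → 𝔸} (hf : ContDiffAt ℝ 4 f b₀) {B : ℝ → ι → 𝔸}
    {B₀ δB : ι → 𝔸} (hB : HasDerivAt B δB 0) (hB₀ : B 0 = B₀) :
    HasDerivAt (fun s => ∑ n ∈ Finset.range 5, ((n ! : ℝ)⁻¹) • iteratedFDeriv ℝ n f b₀ (fun _ => B s))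
      (∑ n ∈ Finset.range 4, ((n ! : ℝ)⁻¹) • ∑ xs : Fin (n + 1) → ι,
        (kernelE (𝕜 := ℝ) (n + 1) f b₀ xs (fun k => Function.update (fun _ : Fin (n + 1) => B₀) 0 δB k (xs k)) : F)) 0 := by
  have e : (∑ n ∈ Finset.range 4, ((n ! : ℝ)⁻¹) • ∑ xs : Fin (n + 1) → ι,
        (kernelE (𝕜 := ℝ) (n + 1) f b₀ xs (fun k => Function.update (fun _ : Fin (n + 1) => B₀) 0 δB k (xs k)) : F))
      = ∑ n ∈ Finset.range 4, ((n ! : ℝ)⁻¹) •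
          iteratedFDeriv ℝ (n + 1) f b₀ (Function.update (fun _ : Fin (n + 1) => B₀) 0 δB) := by
    refine Finset.sum_congr rfl fun n _ => ?_
    rw [iteratedFDeriv_apply_eq_sum_kernelE]
  rw [e]
  exact B12Eq46Frechet.hasDerivAt_taylorSum hf hB hB₀

/-- **(4.20) in kernel form** (p. 285: *«(4.6) = Σ_{n=2}^{4} (1/(n−1)!) ⟨𝐄⁽ⁿ⁾, δB, ⊗^{n−1}B⟩»*): under (4.14) `(δ/δB)𝐄(1) = 0`, read
`fderiv ℝ 𝐄 b₀ = 0`, the `t_□`-derivative (4.6) along the printed curve `τ ↦ Q(ηΛ(x + τv))` equals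
`Σ_{n=2}^{4} (1/(n−1)!) Σ_{(x₁,μ₁)…(x_n,μ_n)} 𝐄⁽ⁿ⁾_{μ₁…μ_n}(x₁…x_n)[δB(x₁,μ₁), B(x₂,μ₂), …, B(x_n,μ_n)]` with `B = Q(ηΛ(x))`,
`δB = ⟨(δQ/δA)(ηΛ(x)), η⟨(δΛ/δ𝐀)(x), v⟩⟩` — gen 8's `B12Eq46Frechet.eq420_of_fderiv_eq_zero` with its three terms expanded by §2
(index written `n ↦ n+1`, `n ∈ {1,2,3}`). [cite: Balaban1987RG1, (4.20) p.285; (4.14) p.284; (4.6) p.282] -/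
theorem eq420_kernel_of_fderiv_eq_zero {f : (ι → 𝔸) → F} {b₀ : ι → 𝔸} (hf : ContDiffAt ℝ 4 f b₀) (h414 : fderiv ℝ f b₀ = 0)
    {Q : EA → ι → 𝔸} {Λ : EA → EA} {η : ℝ} {x : EA} (v : EA)
    (hQ : DifferentiableAt ℝ Q (η • Λ x)) (hΛ : DifferentiableAt ℝ Λ x) :
    HasDerivAt (fun τ : ℝ => ∑ n ∈ Finset.range 5, ((n ! : ℝ)⁻¹) • iteratedFDeriv ℝ n f b₀ (fun _ => Q (η • Λ (x + τ • v))))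
      (∑ n ∈ Finset.Ico 1 4, ((n ! : ℝ)⁻¹) • ∑ xs : Fin (n + 1) → ι,
        (kernelE (𝕜 := ℝ) (n + 1) f b₀ xs (fun k => Function.update (fun _ : Fin (n + 1) => Q (η • Λ x)) 0
          (fderiv ℝ Q (η • Λ x) (η • fderiv ℝ Λ x v)) k (xs k)) : F)) 0 := by
  have e : (∑ n ∈ Finset.Ico 1 4, ((n ! : ℝ)⁻¹) • ∑ xs : Fin (n + 1) → ι,
        (kernelE (𝕜 := ℝ) (n + 1) f b₀ xs (fun k => Function.update (fun _ : Fin (n + 1) => Q (η • Λ x)) 0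
          (fderiv ℝ Q (η • Λ x) (η • fderiv ℝ Λ x v)) k (xs k)) : F))
      = ∑ n ∈ Finset.Ico 1 4, ((n ! : ℝ)⁻¹) •
          iteratedFDeriv ℝ (n + 1) f b₀ (Function.update (fun _ : Fin (n + 1) => Q (η • Λ x)) 0
            (fderiv ℝ Q (η • Λ x) (η • fderiv ℝ Λ x v))) := by
    refine Finset.sum_congr rfl fun n _ => ?_
    rw [iteratedFDeriv_apply_eq_sum_kernelE]
  rw [e]
  exact B12Eq46Frechet.eq420_of_fderiv_eq_zero hf h414 v hQ hΛ

end Eq420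

end Literature.MathematicalPhysics.QuantumFieldTheory.Balaban1983to89.B12Eq419Kernel

end
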